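import Literature.IUT.LogVolume.Theorem110GenuineStepIIPinned
import Literature.IUT.LogVolume.GenuineLogThetaPoint
import HarnessLib

/-!
# The ramification/Galois facts of the tower `F_tpd ⊆ F ⊆ K` of a genuine Θ-volume datum, bundled in the shape of
# the route's Step (ii)–(v) junction ([IUTchIV] Thm. 1.10 Steps (ii)–(iii) inputs)

Mochizuki, *Inter-universal Teichmüller theory IV*, RIMS manuscript (Apr. 2020; = PRIMS **57** (2021)), proof of Thm.
1.10, Steps (ii)–(iii), pp. 24–26: the printed inputs "`Gal(F/F_tpd) ↪ GL_2(𝔽_3) × GL_2(𝔽_5) × ℤ/2ℤ`", "`Gal(K/F) ↪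
GL_2(𝔽_l)`", "`F/F_tpd` is tamely ramified over such primes — cf. Proposition 1.8, (vi), (vii)", "`K/F` is tamely
ramified at the primes that do not divide `l`", and (D0). abc-iut-S3's junction
`Summit.ABC.IUTFork.PointDict.hullEstimateOf_BIII_of_towerFacts` (`LDHGenuineTowerArith.lean`) takes, for a genuine
Θ-volume datum `T : Cor22.ThetaVolumeDatumAt P l`, a bundle `H` of eleven facts; THIS FILE proves the nine
RAMIFICATION/GALOIS components for EVERY datum (`ThetaVolumeDatumAt.towerFacts`), in exactly the junction's shapes (the
place of `F_tpd` under a place `u` of `K` written two-step `finBelow P.F T.F (finBelow T.F T.K u)`), from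
`Theorem110GenuineStepIIPinned.lean` / `SubThetaFieldUnramified.lean` / `Theorem110GenuineStepIIDatum.lean` and
abc-iut-L5-t2/L5-t7's [IUTchI] Rmk. 3.1.5 (`InitialThetaData.isGalois_fieldOfModuli_K`):
`IsGalois F_tpd F`, `IsGalois F K`, `IsGalois F_mod K`, `∃ a ≤ 14, [F:F_tpd] ∣ 2^a·3^2·5` (`a = 12`),
`[K:F] ∣ l(l−1)²(l+1)`, `hKgood`, `hKbad`, `hFgood`, `hFtame`. The two remaining components of `H` are NOT ramification
facts and are not claimed here: `hR4` (the (R4) void-branch budget, abc-iut-S1) and `hconst` (slot-constancy of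
`log(q_v)` over each support prime — the cell's STEPV-IND1 residue, a genuine hypothesis when `d_mod > 1`).
Theorems only; classical; TAKES NO SIDE on [IUTchIII] Cor. 3.12.
-/

noncomputable section

open scoped Classical

namespace Literature.IUT.LogVolume

namespace Cor22

namespace ThetaVolumeDatumAt

open NumberField IsDedekindDomain Literature.NumberTheory.DiophantineGeometry.GenEll Literature.IUT.HodgeTheaters
open Literature.NumberTheory.NumberFields

variable {P : NFPoint} {l : ℕ} (T : ThetaVolumeDatumAt P l)

/-- **The nine ramification/Galois facts of the tower of a genuine Θ-volume datum** (reading v3), in the shape of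
abc-iut-S3's junction `hullEstimateOf_BIII_of_towerFacts`: for `λ ∈ U_X` (the prime `l` of the datum is `≥ 5`),
`F/F_tpd`, `K/F`, `K/F_mod` are Galois; `[F:F_tpd] ∣ 2^{12}·3²·5` (so `∃ a ≤ 14`); `[K:F] ∣ l(l−1)²(l+1)`; `K/F` is
unramified at the places `w ∤ l` over the good places of `λ` and tame (`p_u ∤ e`) at those over the bad places;
`F/F_tpd` is unramified at the good places of residue characteristic `∉ {2,3,5}` and tame away from `{2,3,5}`.
[cite: Mochizuki2012, IUTchIV Thm. 1.10 proof Steps (ii)–(iii) p. 24–26] -/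
theorem towerFacts (hU : P.InU) :
    (letI := T.instFieldF; letI := T.instNumberFieldF; letI := T.instAlgebraF; letI := T.instFieldK
     letI := T.instNumberFieldK; letI := T.instAlgebraK; letI := T.instFieldFbar; letI := T.instAlgebraFbar
     letI := T.instAlgebraKFbar; letI := T.instIsElliptic
     IsGalois P.F T.F ∧ IsGalois T.F T.K ∧ IsGalois (fieldOfModuli T.E) T.K ∧
     (∃ a : ℕ, a ≤ 14 ∧ Module.finrank P.F T.F ∣ 2 ^ a * 3 ^ 2 * 5) ∧
     Module.finrank T.F T.K ∣ l * (l - 1) ^ 2 * (l + 1) ∧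
     (∀ u : HeightOneSpectrum (𝓞 T.K), residueChar T.K u ≠ l →
       finBelow P.F T.F (finBelow T.F T.K u) ∉ Cor22.badPlaces P → u.asIdeal.ramificationIdx (𝓞 T.F) = 1) ∧
     (∀ u : HeightOneSpectrum (𝓞 T.K), residueChar T.K u ≠ l →
       finBelow P.F T.F (finBelow T.F T.K u) ∈ Cor22.badPlaces P →
         ¬ residueChar T.K u ∣ u.asIdeal.ramificationIdx (𝓞 T.F)) ∧
     (∀ w : HeightOneSpectrum (𝓞 T.F), residueChar T.F w ∉ ({2, 3, 5} : Finset ℕ) →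
       finBelow P.F T.F w ∉ Cor22.badPlaces P → w.asIdeal.ramificationIdx (𝓞 P.F) = 1) ∧
     (∀ w : HeightOneSpectrum (𝓞 T.F), residueChar T.F w ∉ ({2, 3, 5} : Finset ℕ) →
       ¬ residueChar T.F w ∣ w.asIdeal.ramificationIdx (𝓞 P.F))) := by
  letI := T.instFieldF; letI := T.instNumberFieldF; letI := T.instAlgebraF; letI := T.instFieldK
  letI := T.instNumberFieldK; letI := T.instAlgebraK; letI := T.instFieldFbar; letI := T.instAlgebraFbar
  letI := T.instAlgebraKFbar; letI := T.instIsElliptic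
  have hl : l.Prime := T.D.l_prime
  haveI : Fact l.Prime := ⟨hl⟩
  haveI := T.D.isScalarTower
  haveI := T.D.isAlgClosure
  haveI := T.D.isGalois_fieldOfModuli
  have hGalF : IsGalois P.F T.F := isGalois_tpd_of_isGalois_fieldOfModuli T.j_eq
  have hGalK : IsGalois T.F T.K := isGalois_F_K_of_initialThetaData T.D
  have hGalMod : IsGalois (fieldOfModuli T.E) T.K := T.D.isGalois_fieldOfModuli_K
  haveI := hGalF; haveI := hGalK
  -- the embedding `K → AlgebraicClosure F` inside the `l`-division field
  let ι : T.Fbar ≃ₐ[T.F] AlgebraicClosure T.F := IsAlgClosure.equiv T.F T.Fbar (AlgebraicClosure T.F)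
  let ψ : T.K →ₐ[T.F] AlgebraicClosure T.F :=
    (ι : T.Fbar →ₐ[T.F] AlgebraicClosure T.F).comp (IsScalarTower.toAlgHom T.F T.K T.Fbar)
  have hK : (T.E.galoisRepTorsion (l : ℤ)).ker ≤ ψ.fieldRange.fixingSubgroup :=
    ker_galoisRepTorsion_le_fixingSubgroup_of_initialThetaData T.D ι
  have hss : T.E.IsSemistable (𝓞 T.F) := T.D.isSemistable
  have hdegF : Module.finrank P.F T.F ∣ 2 ^ 12 * 3 ^ 2 * 5 := by
    haveI : Fact P.InU := ⟨hU⟩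
    have h := (T.isSubThetaField.finrank_dvd (subThetaFieldGenerators_splits_thetaClosureField P hU)).trans
      (finrank_thetaClosureField_dvd P hU)
    norm_num at h ⊢
    exact h
  refine ⟨hGalF, hGalK, hGalMod, ⟨12, by norm_num, hdegF⟩, finrank_dvd_of_ker_le ψ hK, ?_, ?_, ?_, ?_⟩
  · intro u hu hgood
    exact ramificationIdx_eq_one_of_ker_le ψ hss T.j_eq hK u (natCast_notMem_finBelow_of_residueChar_ne hl u hu) hgood
  · intro u hu _
    exact not_dvd_ramificationIdx_of_ker_le ψ hss T.j_eq hl hK u (natCast_notMem_finBelow_of_residueChar_ne hl u hu)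
      (residueChar_prime T.K u) hu
  · intro w hw hgood
    exact ramificationIdx_subThetaField_eq_one T.F hU T.isSubThetaField w
      (thirty_notMem_finBelow_of_residueChar_notMem w hw) hgood
  · intro w hw
    simp only [Finset.mem_insert, Finset.mem_singleton, not_or] at hw
    obtain ⟨h2, h3, h5⟩ := hw
    haveI := w.isPrime
    haveI : (finBelow P.F T.F w).asIdeal.IsMaximal := (finBelow P.F T.F w).isMaximal
    intro h
    have h' := (h.trans (ramificationIdx_dvd_finrank_of_isGalois (finBelow P.F T.F w).asIdeal w.asIdeal)).trans hdegF
    have hp := residueChar_prime T.F w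
    rcases (Nat.Prime.dvd_mul hp).1 h' with h23 | h5'
    · rcases (Nat.Prime.dvd_mul hp).1 h23 with h2' | h3'
      · exact h2 ((Nat.prime_dvd_prime_iff_eq hp Nat.prime_two).1 (hp.dvd_of_dvd_pow h2'))
      · exact h3 ((Nat.prime_dvd_prime_iff_eq hp Nat.prime_three).1 (hp.dvd_of_dvd_pow h3'))
    · exact h5 ((Nat.prime_dvd_prime_iff_eq hp (by norm_num)).1 h5')

end ThetaVolumeDatumAt

end Cor22

end Literature.IUT.LogVolume

end
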